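import Summits.QuantumFields.YangMills.Theorems.BalabanUVNodesK0Stub1SectFWSlotAtRecordSocket
import Summits.QuantumFields.YangMills.Theorems.BalabanUVNodesK0Stub1FlatChartQlinLetters
import Summits.QuantumFields.YangMills.Theorems.BalabanUVNodesK0Stub1FlatHTransposeLetterAtRecord
import Summits.QuantumFields.YangMills.Theorems.BalabanUVNodesK0Stub1FlatHRescaledRowsAtRecord
import HarnessLib

/-!
# K0⁷ STUB 1 (`stub_prop8StepCoP13`), sub-target S4b — **THE ♭ JUNCTION: k0-s1-w2's CHART SOCKET AT `Q := Qlin♭ = (Lʲη)•Q_V`, `H := H♭ = H_V∘((Lʲη)⁻¹•·)`,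
# `MV := η^d•M_V`, `wB′ ≡ 1` — THE W-SLOT OF (157) AT EVERY ADMISSIBLE FAMILY OF THE RECORD's FOUR-TORI WITH `O₁`, `q₀ = 2`, `q = L`, `h₀`, `B₀ = B₁ = B♭` ALL DISCHARGED,
# MODULO `θ₀` (the chart-derivative transpose letter) AND THE ♭ CHART's REMAINDER SOCKET (`ε`, `C_D`, `Dfun`, (55), analyticity)**

Cell `pub-ymgap`, width seat `pub-ymgap-k0-s1-w4` g0′ (FILE 11; reading (R1′) of the LOCATED-Q0-COMB finding).  `--kind proof --supports stmt-QuantumFields-20541 --as helper`;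
count-neutral.  [15] = [Balaban1985Variational]; [B6] = [Balaban1984PropagatorsII].

WHY.  The S4b capstone's displayed letters are k-uniform only on the double-bar ∕ ♭ road (k0-s1-w4 LOCATED-Q0-COMB, certified by k0-s1-w2's p619371): the single-bar
`Qlin = D(chartLog)(0)` carries the comb `−η∂Λ_j`, whose transpose costs `q₀ ≳ L^{3(K−n)}`.  k0-s1-w2 g4 therefore cut the chart out of the capstone
(`K0Stub1SectFWSlotAtRecordSocket.exists_sectF_W_atRecord_of_chartSocket_O1`: ANY `Q`, ANY `H` through its two (46) rows, ANY remainder socket `Dfun`).  This file plugs the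
♭ objects into that socket and discharges every numeric letter this seat owns: `Q := fderiv ℂ (chartLogFlat η D) 0` (`= (Lʲη)•Q_V`, FILE 9: `q = L`, `q₀ = 2` at `wB′ ≡ 1`
for EVERY transpose), `H :=` any `ℂ`-linear map with the ♭ kernel `Σ_t ((L^{j(t)}η)⁻¹·(flatH e_t)(b))•X_t` (FILE 10: `hHB`, `hHgrad` with `B♭`; FILE 8: `h₀` for EVERY transpose),
`MV := η^d•M_V` (p616957: `O₁`, inside the socket).  What remains displayed: `θ₀` (the transpose letter of `D(Dfun)(A′)`, the chart lane's) and `ℓ`.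

WHAT IS PROVED (sorry-free; no definition; axioms standard).
* §1 `nonempty_bondIdx` — every nested family has an index bond (`Λ ≠ ∅`; used for `0 ≤ s`).
* §2 ★★★ `exists_sectF_W_atRecord_flatChart` — for every `F : T4Family`, `N ≥ 1`: `∃ Mh₀ R₀, O₁ B♭ h₀ ≥ 0` such that at every admissible nested family of the record's tori in the
  standing range, for the (152) weights, EVERY `ℂ`-linear `H` with the ♭ kernel, EVERY remainder socket (`ε > 0`, `C_D ≥ 0`, `Dfun`, (55), `ContDiffOn ℂ ω`), the
  fibre letters (`τ`, `ρ`), the pairings (27) and `Σ_t τ`, EVERY `M_V` with p598821's kernel: there are the transposes `Qt, Ht, Dt` (w.r.t. `Q := Qlin♭`, `H`, `D(Dfun)`) and,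
  for every `θ₀ ≥ 0` and `ℓ` with `1 + B♭C_Dε ≤ ℓ`, `ℓε ≤ 1∕16` and the ONE remaining letter `h73t` (`w₃(b)‖Dt A′ X b‖ ≤ θ₀·r·s` for `1·‖X_i‖ ≤ s`), a shift-compatible chart
  `e` and a map `W` with (157)'s `HasFDerivAt`, `DifferentiableOn` on the `ε`-window, and the (158) row
  `w₃(b)‖W Y b‖ ≤ (θ₀O₁(C_Dε + L) + 2·O₁·C_D + (1 + θ₀εh₀)·((d−1)(L²)³M_ρ(200 + 2L²))·ℓ²)·r²`.
HONEST SCOPE.  Assembly of k0-s1-w2's socket with this seat's letters; the remainder socket and `θ₀` stay displayed; nothing of Bałaban's analysis asserted; `stub_prop8StepCoP13`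
∕ K0⁷ NOT closed; N07 NOT discharged; no summit statement is proved by this seat; counts unmoved (28∕28 · 5∕27); R4 closes the conditional finite-𝕋⁴ rung `BalabanLadder.UV`
only, never the summit; the YM mass gap (Clay) is NOT proved by any of this; nothing continuum ∕ ℝ⁴ ∕ OS.  No `sorry`, no `def`, no `instance`, no `notation`.
References: [15] (27) p.282, (44)–(46) p.285, (55) p.286, Prop. 4 (97)–(98) pp.292–293, (152) p.301, (157)–(158) p.302, (161)–(162) p.303; [B6] (2.35) p.228, Cor. 2.8
(2.150)–(2.151) p.249; [Balaban1984PropagatorsI] (1.18) p.20; [Balaban1987RG1] (0.1) p.251.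
-/

set_option autoImplicit false

noncomputable section

open scoped BigOperators Matrix.Norms.L2Operator Topology ContDiff

namespace Summit.QuantumFields.YangMills.Theorems.K0Stub1SectFWSlotAtRecordFlatChart

open Literature.MathematicalPhysics.QuantumFieldTheory.Balaban1983to89
open Literature.MathematicalPhysics.QuantumFieldTheory.Balaban1983to89.T4Continuum (T4Family)
open B6SectADomainsV1 (Domains)
open B6SectAOperatorsV1 (BondIdx aE)
open B6SectAVectorModelV1 (EE)
open B9Eq39Adjoint (bondPair)
open B11Eq26ActionExpansion (V0)
open B4Sect5Torus (TSite)
open Summit.QuantumFields.YangMills.Theorems.FlatCubeOpsText (Adm22)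
open Summit.QuantumFields.YangMills.Theorems.K0FlatCubeOpsTextP (IsLevWeight flatH)
open Summit.QuantumFields.YangMills.Theorems.Prop8ChartDoubleBar (chartLogFlat)
open Summit.QuantumFields.YangMills.Theorems.K0Stub1PairingsAtExtensions (bondPair_PBond_eq_sum)
open Summit.QuantumFields.YangMills.Theorems.K0Stub1SectFWSlotAtRecordSocket (exists_sectF_W_atRecord_of_chartSocket_O1)
open Summit.QuantumFields.YangMills.Theorems.K0Stub1FlatChartQlinLetters (fderiv_chartLogFlat_zero_kernel hQ_chartLogFlat_of_adm22 hQt'_chartLogFlat_unitWeight_T4)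
open Summit.QuantumFields.YangMills.Theorems.K0Stub1FlatHTransposeLetterAtRecord (adjointHt_apply_eq_kernel h46t_unitWeight_of_adm22_T4)
open Summit.QuantumFields.YangMills.Theorems.K0Stub1FlatHRescaledRowsAtRecord (rescaledRows_of_adm22_T4)

/-! ## §1  Every nested family has an index bond (`Λ ≠ ∅`) -/

/-- **`Λ ≠ ∅`**: every nested family of domains (`Ω₀ = T`, `Ω_j = ∅` beyond `k`) has an index bond: at the largest level `j ≤ k` with `Ω_j ≠ ∅`, no `j`-block is deep
(`Ω_{j+1} = ∅`), so every bond at a site of `Ω_j^{(j)}` lies in `Λ_j`. [cite: Balaban1984PropagatorsII, (2.1)-(2.3) p.224] -/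
theorem nonempty_bondIdx {P : Params} (D : Domains P) (hd : 0 < P.d) : Nonempty (BondIdx D) := by
  classical
  have h0 : (D.Om 0).Nonempty := by rw [D.Om_zero]; exact ⟨fun _ => 0, Finset.mem_univ _⟩
  set j : ℕ := Nat.findGreatest (fun j => (D.Om j).Nonempty) D.k with hj
  have hjk : j ≤ D.k := Nat.findGreatest_le _
  have hPj : (D.Om j).Nonempty := Nat.findGreatest_spec (P := fun j => (D.Om j).Nonempty) (Nat.zero_le _) h0
  have hempty : D.Om (j + 1) = ∅ := by
    by_cases h : j + 1 ≤ D.k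
    · exact Finset.not_nonempty_iff_eq_empty.1 (Nat.findGreatest_is_greatest (P := fun j => (D.Om j).Nonempty) (Nat.lt_succ_self j) h)
    · exact D.Om_eq_empty (by omega)
  obtain ⟨y, hy⟩ := hPj
  have hnd : ∀ y' : Site P j, ¬ D.Deep j y' := fun y' h => by
    unfold Domains.Deep at h; rw [hempty] at h; simp at h
  exact ⟨⟨⟨⟨j, Nat.lt_succ_of_le hjk⟩, ⟨y, ⟨0, hd⟩⟩⟩, ⟨Or.inl hy, hnd _, hnd _⟩⟩⟩

/-! ## §2  The ♭ junction -/

/-- ★★★ **THE ♭ JUNCTION — k0-s1-w2's CHART SOCKET AT `Q := Qlin♭`, `H := H♭`, `MV := η^d•M_V`, `wB′ ≡ 1`, WITH `O₁`, `q₀ = 2`, `q = L`, `h₀`, `B₀ = B₁ = B♭` DISCHARGED.**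
For every `F : T4Family`, `N ≥ 1`: `∃ Mh₀ R₀, O₁ B♭ h₀ ≥ 0` such that at every admissible nested family of the record's tori in the standing range (`1 ≤ K − n`, `K − n + 1 ≤ m + K`,
`M_h = L^{a′} ≥ Mh₀`, `R ≥ R₀`, `a′ + 3 ≤ m + n`, `D.k = K − n`, `Adm22 D R (L·M_h)`), for the (152) weights, EVERY `ℂ`-linear `H` with the ♭ kernel
`(H X)(b) = Σ_t ((L^{j(t)}η)⁻¹·(flatH e_t)(b))•X_t`, EVERY remainder socket (`ε > 0`, `C_D ≥ 0`, `Dfun` with (55) and `ContDiffOn ℂ ω` on the `ε`-ball), the fibre letters, the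
pairings (27) and `Σ_t τ`, EVERY `M_V` with p598821's kernel (`B`-symmetric): there are CLMs `Qt, Ht` and `Dt A′` — the transposes of `Qlin♭ := fderiv ℂ (chartLogFlat η D) 0`, of `H`
and of `D(Dfun)(A′)` — and for every `θ₀ ≥ 0`, `ℓ` with `1 + B♭C_Dε ≤ ℓ`, `ℓε ≤ 1∕16` and the letter `h73t` at unit block weight, a shift-compatible chart `e` and a `W` with
(157)'s `HasFDerivAt` (at `Q := Qlin♭`, `MV := η^d•M_V`), `DifferentiableOn` on the `ε`-window and the (158) row with
`C₄ = θ₀O₁(C_Dε + L) + 2·O₁·C_D + (1 + θ₀εh₀)·((d − 1)(L²)³M_ρ(200 + 2L²))·ℓ²`.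
[cite: Balaban1985Variational, Prop. 4 (97)-(98) pp.292-293, (157)-(158) p.302, (44)-(46) p.285, (152) p.301, (161)-(162) p.303; Balaban1984PropagatorsII, Cor. 2.8 (2.150)-(2.151) p.249; Balaban1984PropagatorsI, (1.18) p.20; Balaban1987RG1, (0.1) p.251] -/
theorem exists_sectF_W_atRecord_flatChart (N : ℕ) [NeZero N] (F : T4Family) :
    ∃ (Mh₀ R₀ : ℕ) (O₁ Bf h₀ : ℝ), 0 ≤ O₁ ∧ 0 ≤ Bf ∧ 0 ≤ h₀ ∧
    ∀ (n K : ℕ) (_ : 1 ≤ K - n) (_ : K - n + 1 ≤ F.m + K) {Mh R a' : ℕ} (_ : Mh = F.L ^ a') (_ : Mh₀ ≤ Mh) (_ : R₀ ≤ R)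
      (_ : a' + 3 ≤ F.m + n) (D : Domains (F.P K)) (hDk : D.k = K - n) (_ : Adm22 D R (F.L * Mh))
      [Fact ((0 : ℝ) < ((F.P K).L : ℝ))] [Fact ((0 : ℝ) < (((F.P K).L : ℝ))⁻¹ ^ (K - n))]
    {w : ℕ → PBond (F.P K) 0 → ℝ} (hw : IsLevWeight (F.P K) (K - n) D w)
    -- the ♭ right inverse: ANY ℂ-linear map with the kernel `(L^{j(t)}η)⁻¹·(flatH e_t)(b)`
    (H : (BondIdx D → Matrix (Fin N) (Fin N) ℂ) →ₗ[ℂ] (PBond (F.P K) 0 → Matrix (Fin N) (Fin N) ℂ))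
    (hH : ∀ (X : BondIdx D → Matrix (Fin N) (Fin N) ℂ) (b : PBond (F.P K) 0), H X b =
      ∑ t, (((((F.P K).L : ℝ) ^ (t.1.1 : ℕ) * ((((F.P K).L : ℝ))⁻¹) ^ (K - n))⁻¹ * flatH (F.P K) (K - n) D (Pi.single t 1) b : ℝ) : ℂ) • X t)
    -- the remainder socket of the ♭ chart (displayed)
    {ε : ℝ} (hε : 0 < ε) {CD : ℝ} (hCD : 0 ≤ CD)
    (Dfun : (PBond (F.P K) 0 → Matrix (Fin N) (Fin N) ℂ) → (BondIdx D → Matrix (Fin N) (Fin N) ℂ))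
    (h55 : ∀ A' : PBond (F.P K) 0 → Matrix (Fin N) (Fin N) ℂ, (∀ b, w 1 b * ‖A' b‖ < ε) →
      ∀ ρ' : ℝ, 0 ≤ ρ' → (∀ b, w 1 b * ‖A' b‖ ≤ ρ') → ∀ i, ‖Dfun A' i‖ ≤ CD * ρ' ^ 2)
    (hcd : ContDiffOn ℂ ω Dfun {Y : PBond (F.P K) 0 → Matrix (Fin N) (Fin N) ℂ | ∀ b, w 1 b * ‖Y b‖ < ε})
    -- the fibre letters and the pairings
    (τ : Matrix (Fin N) (Fin N) ℂ →L[ℂ] ℂ) (ρ : (Matrix (Fin N) (Fin N) ℂ →L[ℂ] ℂ) →L[ℂ] Matrix (Fin N) (Fin N) ℂ)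
    (hρ : ∀ (ℓ' : Matrix (Fin N) (Fin N) ℂ →L[ℂ] ℂ) (X : Matrix (Fin N) (Fin N) ℂ), τ (ρ ℓ' * X) = ℓ' X)
    (hτ : ∀ a b : Matrix (Fin N) (Fin N) ℂ, τ (a * b) = τ (b * a)) (hτs : ∀ a : Matrix (Fin N) (Fin N) ℂ, τ (star a) = starRingEnd ℂ (τ a))
    (hτ1 : ∀ X : Matrix (Fin N) (Fin N) ℂ, ‖τ X‖ ≤ ‖X‖) {Mρ : ℝ} (hMρ : 0 ≤ Mρ) (hρn : ∀ ℓ' : Matrix (Fin N) (Fin N) ℂ →L[ℂ] ℂ, ‖ρ ℓ'‖ ≤ Mρ * ‖ℓ'‖)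
    (BE : (PBond (F.P K) 0 → Matrix (Fin N) (Fin N) ℂ) →L[ℂ] (PBond (F.P K) 0 → Matrix (Fin N) (Fin N) ℂ) →L[ℂ] ℂ)
    (hBE : ∀ Y δ : PBond (F.P K) 0 → Matrix (Fin N) (Fin N) ℂ, BE Y δ =
      bondPair ((((F.P K).L : ℝ))⁻¹ ^ (K - n)) (F.P K).d (τ : Matrix (Fin N) (Fin N) ℂ →ₗ[ℂ] ℂ) (fun μ x => Y ⟨x, μ⟩) (fun μ x => δ ⟨x, μ⟩))
    (B : (BondIdx D → Matrix (Fin N) (Fin N) ℂ) →L[ℂ] (BondIdx D → Matrix (Fin N) (Fin N) ℂ) →L[ℂ] ℂ)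
    (hB : ∀ X X' : BondIdx D → Matrix (Fin N) (Fin N) ℂ, B X X' = ∑ t, τ (X t * X' t)) (hBsymm : ∀ a b, B a b = B b a)
    -- the multiplier of record
    (hc : ((F.P K).L : ℝ) ^ (K - n) ≠ 0) {wa : BondIdx D → ℝ} (hwa : ∀ i, 0 < wa i)
    (MV : (BondIdx D → Matrix (Fin N) (Fin N) ℂ) →L[ℂ] (BondIdx D → Matrix (Fin N) (Fin N) ℂ))
    (hMV : ∀ (X : BondIdx D → Matrix (Fin N) (Fin N) ℂ) (t : BondIdx D),
      MV X t = ∑ s, ((WithLp.ofLp ((EE D hc hwa - aE D wa) (WithLp.toLp 2 (Pi.single s 1))) t : ℝ) : ℂ) • X s)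
    (hMsym : ∀ a b, B (MV a) b = B a (MV b)),
    ∃ (Qt : (BondIdx D → Matrix (Fin N) (Fin N) ℂ) →L[ℂ] (PBond (F.P K) 0 → Matrix (Fin N) (Fin N) ℂ)) (Ht : (PBond (F.P K) 0 → Matrix (Fin N) (Fin N) ℂ) →L[ℂ] (BondIdx D → Matrix (Fin N) (Fin N) ℂ))
      (Dt : (PBond (F.P K) 0 → Matrix (Fin N) (Fin N) ℂ) → ((BondIdx D → Matrix (Fin N) (Fin N) ℂ) →L[ℂ] (PBond (F.P K) 0 → Matrix (Fin N) (Fin N) ℂ))),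
      (∀ X δ, BE (Qt X) δ = B X (fderiv ℂ (chartLogFlat (((((F.P K).L : ℝ))⁻¹) ^ (K - n)) D :
        (PBond (F.P K) 0 → Matrix (Fin N) (Fin N) ℂ) → BondIdx D → Matrix (Fin N) (Fin N) ℂ) 0 δ)) ∧
      (∀ Z X, BE Z (H X) = B (Ht Z) X) ∧
      (∀ (A' : PBond (F.P K) 0 → Matrix (Fin N) (Fin N) ℂ) X δ, BE (Dt A' X) δ = B X (fderiv ℂ Dfun A' δ)) ∧
      ∀ (θ₀ ℓ : ℝ), 0 ≤ θ₀ → 1 + Bf * CD * ε ≤ ℓ → ℓ * ε ≤ 1 / 16 →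
        (∀ (A' : PBond (F.P K) 0 → Matrix (Fin N) (Fin N) ℂ) (r : ℝ), (∀ b, w 1 b * ‖A' b‖ ≤ r) →
          (∀ (b : PBond (F.P K) 0) (ν : Fin (F.P K).d), w 2 b * ((F.P K).L : ℝ) ^ (K - n) * ‖A' ⟨b.src.shift ν, b.dir⟩ - A' b‖ ≤ r) → r < ε →
          ∀ (X : BondIdx D → Matrix (Fin N) (Fin N) ℂ) (s : ℝ), (∀ i, (1 : ℝ) * ‖X i‖ ≤ s) → ∀ b, w 3 b * ‖Dt A' X b‖ ≤ θ₀ * r * s) →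
        ∃ (e : Site (F.P K) 0 ≃ TSite (F.P K).d (fun _ => (F.P K).sitesPerDir 0)) (W : (PBond (F.P K) 0 → Matrix (Fin N) (Fin N) ℂ) → (PBond (F.P K) 0 → Matrix (Fin N) (Fin N) ℂ)),
          (∀ (x : Site (F.P K) 0) (μ : Fin (F.P K).d), e (x.shift μ) = B9SectCLatticeCarrier.shift μ (e x)) ∧
          (∀ A' : PBond (F.P K) 0 → Matrix (Fin N) (Fin N) ℂ, (∀ b, w 1 b * ‖A' b‖ < ε) →
            (∀ (b : PBond (F.P K) 0) (ν : Fin (F.P K).d), w 2 b * ((F.P K).L : ℝ) ^ (K - n) * ‖A' ⟨b.src.shift ν, b.dir⟩ - A' b‖ < ε) →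
            HasFDerivAt (fun A : PBond (F.P K) 0 → Matrix (Fin N) (Fin N) ℂ => 2⁻¹ * B (Dfun A) (((((((((F.P K).L : ℝ))⁻¹) ^ (K - n) : ℝ) : ℂ) ^ (F.P K).d) • MV) (Dfun A))
                - B (fderiv ℂ (chartLogFlat (((((F.P K).L : ℝ))⁻¹) ^ (K - n)) D :
                    (PBond (F.P K) 0 → Matrix (Fin N) (Fin N) ℂ) → BondIdx D → Matrix (Fin N) (Fin N) ℂ) 0 A)
                    (((((((((F.P K).L : ℝ))⁻¹) ^ (K - n) : ℝ) : ℂ) ^ (F.P K).d) • MV) (Dfun A))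
                + V0 (LatticeFieldCalculus.shiftEquiv (P := F.P K) (j := 0)) (fun _ _ => (1 : (Matrix (Fin N) (Fin N) ℂ)ˣ)) ((((F.P K).L : ℝ)⁻¹) ^ (K - n)) (F.P K).d
                    (τ : Matrix (Fin N) (Fin N) ℂ →ₗ[ℂ] ℂ) (fun μ x => (A - H (Dfun A)) ⟨x, μ⟩))
              (BE (W A')) A') ∧
          DifferentiableOn ℂ W {Y : PBond (F.P K) 0 → Matrix (Fin N) (Fin N) ℂ | (∀ b, w 1 b * ‖Y b‖ < ε) ∧
            ∀ (b : PBond (F.P K) 0) (ν : Fin (F.P K).d), w 2 b * ((F.P K).L : ℝ) ^ (K - n) * ‖Y ⟨b.src.shift ν, b.dir⟩ - Y b‖ < ε} ∧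
          (∀ (Y : PBond (F.P K) 0 → Matrix (Fin N) (Fin N) ℂ) (r : ℝ), r < ε → (∀ b, w 1 b * ‖Y b‖ ≤ r) →
            (∀ (b : PBond (F.P K) 0) (ν : Fin (F.P K).d), w 2 b * ((F.P K).L : ℝ) ^ (K - n) * ‖Y ⟨b.src.shift ν, b.dir⟩ - Y b‖ ≤ r) →
            ∀ b, w 3 b * ‖W Y b‖ ≤
              (θ₀ * O₁ * (CD * ε + ((F.P K).L : ℝ)) + 2 * O₁ * CD
                + (1 + θ₀ * ε * h₀) * ((((F.P K).d - 1 : ℕ) : ℝ) * (((F.P K).L : ℝ) ^ 2) ^ 3 * Mρ * (200 + 2 * ((F.P K).L : ℝ) ^ 2)) * ℓ ^ 2)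
                * r ^ 2) := by
  classical
  obtain ⟨Mh₁, R₁, O₁, hO₁, hsock⟩ := exists_sectF_W_atRecord_of_chartSocket_O1 N F
  obtain ⟨Mh₂, R₂, Bf, hBf, hrows⟩ := rescaledRows_of_adm22_T4 F
  obtain ⟨Mh₃, R₃, h₀, hh₀, h46⟩ := h46t_unitWeight_of_adm22_T4 F
  refine ⟨max Mh₁ (max Mh₂ Mh₃), max (max R₁ (max R₂ R₃)) 2, O₁, Bf, h₀, hO₁, hBf, hh₀, ?_⟩
  intro n K hk1 hk' Mh R a' hMha hMh hR hsize D hDk hAdm _ _ w hw H hH ε hε CD hCD Dfun h55 hcd τ ρ hρ hτ hτs hτ1 Mρ hMρ hρn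
    BE hBE B hB hBsymm hc wa hwa MV hMV hMsym
  have hL0 : (0 : ℝ) < ((F.P K).L : ℝ) := by exact_mod_cast (F.P K).L_pos
  have hMh₁ : Mh₁ ≤ Mh := le_trans (le_max_left _ _) hMh
  have hMh₂ : Mh₂ ≤ Mh := le_trans (le_trans (le_max_left _ _) (le_max_right _ _)) hMh
  have hMh₃ : Mh₃ ≤ Mh := le_trans (le_trans (le_max_right _ _) (le_max_right _ _)) hMh
  have hR₁ : R₁ ≤ R := le_trans (le_trans (le_max_left _ _) (le_max_left _ _)) hR
  have hR₂ : R₂ ≤ R := le_trans (le_trans (le_trans (le_max_left _ _) (le_max_right _ _)) (le_max_left _ _)) hR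
  have hR₃ : R₃ ≤ R := le_trans (le_trans (le_trans (le_max_right _ _) (le_max_right _ _)) (le_max_left _ _)) hR
  have hR2 : 2 ≤ R := le_trans (le_max_right _ _) hR
  have hMh1 : 1 ≤ Mh := by rw [hMha]; exact Nat.one_le_pow _ _ (F.P K).L_pos
  have hRM : 2 * (F.P K).L ≤ R * (F.L * Mh) := by
    have hPL : (F.P K).L = F.L := rfl
    rw [hPL]; calc 2 * F.L ≤ R * (F.L * 1) := by rw [mul_one]; exact Nat.mul_le_mul_right _ hR2
      _ ≤ R * (F.L * Mh) := Nat.mul_le_mul_left _ (Nat.mul_le_mul_left _ hMh1)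
  set η : ℝ := (((F.P K).L : ℝ))⁻¹ ^ (K - n) with hη
  -- the block rescaling `ν_t = (L^{j(t)}η)⁻¹`, `0 ≤ L^{j(t)}η ≤ 1`
  have hνabs : ∀ t : BondIdx D, |((((F.P K).L : ℝ) ^ (t.1.1 : ℕ) * η)⁻¹)| ≤ ((((F.P K).L : ℝ) ^ (t.1.1 : ℕ) * η)⁻¹) :=
    fun t => le_of_eq (abs_of_nonneg (by positivity))
  have hband : ∀ t : BondIdx D, (fun _ : BondIdx D => (1 : ℝ)) t * (((F.P K).L : ℝ) ^ (t.1.1 : ℕ) * η) ≤ 1 := by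
    intro t
    have hj : (t.1.1 : ℕ) ≤ K - n := by have := t.1.1.2; omega
    rw [one_mul, hη, inv_pow, ← div_eq_mul_inv, div_le_one (pow_pos hL0 _)]
    exact pow_le_pow_right₀ (by exact_mod_cast (F.P K).L_pos) hj
  -- the two (46) rows of `H` (FILE 10)
  obtain ⟨hHB, hHgrad⟩ := hrows n K hk1 hk' hMha hMh₂ hR₂ hsize D hDk hAdm w hw _ hνabs (fun X => H X) hH
  -- the socket
  obtain ⟨Qt, Ht, Dt, hQt, hHt, hDt, main⟩ :=
    hsock n K hk1 hk' hMha hMh₁ hR₁ hsize D hDk hAdm hw H hBf hHB hBf hHgrad hε hCD Dfun h55 hcd τ ρ hρ hτ hτs hτ1 hMρ hρn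
      BE hBE B hB hBsymm hc hwa MV hMV hMsym
      (fderiv ℂ (chartLogFlat η D : (PBond (F.P K) 0 → Matrix (Fin N) (Fin N) ℂ) → BondIdx D → Matrix (Fin N) (Fin N) ℂ) 0)
  refine ⟨Qt, Ht, Dt, hQt, hHt, hDt, ?_⟩
  intro θ₀ ℓ hθ₀ hℓ hℓε h73t
  -- nonnegativity of the radii from one index
  have hd : 4 ≤ (F.P K).d := le_of_eq (T4Family.P_d F K).symm
  obtain ⟨i₀⟩ := nonempty_bondIdx D (by omega)
  have b₀ : PBond (F.P K) 0 := ⟨fun _ => 0, ⟨0, by omega⟩⟩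
  have hw3 : ∀ b, 0 ≤ w 3 b := fun b => by rw [hw 3 b]; positivity
  -- `hQt'` (FILE 9, `q₀ = 2`), `h46t` (FILE 8, `h₀`), `hQ` (FILE 9, `q = L`) at unit block weight
  have hQt' : ∀ (X : BondIdx D → Matrix (Fin N) (Fin N) ℂ) (s : ℝ), (∀ i, (fun _ : BondIdx D => (1 : ℝ)) i * ‖X i‖ ≤ s) →
      ∀ b, w 3 b * ‖Qt X b‖ ≤ 2 * s := by
    intro X s hX b
    have hs : 0 ≤ s := le_trans (by rw [one_mul]; exact norm_nonneg _) (hX i₀)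
    exact hQt'_chartLogFlat_unitWeight_T4 F n K D hDk hw τ ρ hρ hτ BE hBE B hB Qt hQt X s hs hX b
  have hBE' : ∀ Y δ : PBond (F.P K) 0 → Matrix (Fin N) (Fin N) ℂ, BE Y δ = (((η : ℝ) : ℂ) ^ (F.P K).d) * ∑ b', τ (Y b' * δ b') := by
    intro Y δ; rw [hBE, bondPair_PBond_eq_sum]; rfl
  have hker : ∀ (Z : PBond (F.P K) 0 → Matrix (Fin N) (Fin N) ℂ) (t : BondIdx D), Ht Z t =
      (((η : ℝ) : ℂ) ^ (F.P K).d) • ∑ b, (((((F.P K).L : ℝ) ^ (t.1.1 : ℕ) * η)⁻¹ * flatH (F.P K) (K - n) D (Pi.single t 1) b : ℝ) : ℂ) • Z b :=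
    fun Z t => adjointHt_apply_eq_kernel (ι := PBond (F.P K) 0) (κ := BondIdx D) τ ρ hρ hτ _ (BE := fun Y δ => BE Y δ) hBE' (B := fun X X' => B X X') hB
      (H := fun X => H X) (fun b t => (((F.P K).L : ℝ) ^ (t.1.1 : ℕ) * η)⁻¹ * flatH (F.P K) (K - n) D (Pi.single t 1) b) hH (Ht := fun Z => Ht Z) hHt Z t
  have hHt' : ∀ (Z : PBond (F.P K) 0 → Matrix (Fin N) (Fin N) ℂ) (t : BondIdx D), Ht Z t =
      ((((η : ℝ) : ℂ) ^ (F.P K).d) * ((((((F.P K).L : ℝ) ^ (t.1.1 : ℕ) * η)⁻¹ : ℝ) : ℂ))) • ∑ b, ((flatH (F.P K) (K - n) D (Pi.single t 1) b : ℝ) : ℂ) • Z b := by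
    intro Z t
    rw [hker Z t]
    simp only [Finset.smul_sum, smul_smul, Complex.ofReal_mul, mul_assoc]
  have h46t : ∀ (Z : PBond (F.P K) 0 → Matrix (Fin N) (Fin N) ℂ) (s : ℝ), (∀ b, w 3 b * ‖Z b‖ ≤ s) →
      ∀ i, (fun _ : BondIdx D => (1 : ℝ)) i * ‖Ht Z i‖ ≤ h₀ * s := by
    intro Z s hZ i
    have hs : 0 ≤ s := le_trans (mul_nonneg (hw3 b₀) (norm_nonneg _)) (hZ b₀)
    exact h46 n K hk1 hk' hMha hMh₃ hR₃ hsize D hDk hAdm hw _ hνabs (fun Z => Ht Z) hHt' Z s hs hZ i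
  have hQ : ∀ (A' : PBond (F.P K) 0 → Matrix (Fin N) (Fin N) ℂ) (r : ℝ), (∀ b, w 1 b * ‖A' b‖ ≤ r) →
      ∀ i, (1 : ℝ) * ‖(fderiv ℂ (chartLogFlat η D : (PBond (F.P K) 0 → Matrix (Fin N) (Fin N) ℂ) → BondIdx D → Matrix (Fin N) (Fin N) ℂ) 0) A' i‖ ≤
        ((F.P K).L : ℝ) * r :=
    fun A' r hA' i => hQ_chartLogFlat_of_adm22 (K - n) D hDk hAdm hRM hw A' r hA' i
  have h73t' : ∀ (A' : PBond (F.P K) 0 → Matrix (Fin N) (Fin N) ℂ) (r : ℝ), (∀ b, w 1 b * ‖A' b‖ ≤ r) →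
      (∀ (b : PBond (F.P K) 0) (ν : Fin (F.P K).d), w 2 b * ((F.P K).L : ℝ) ^ (K - n) * ‖A' ⟨b.src.shift ν, b.dir⟩ - A' b‖ ≤ r) → r < ε →
      ∀ (X : BondIdx D → Matrix (Fin N) (Fin N) ℂ) (s : ℝ), (∀ i, (fun _ : BondIdx D => (1 : ℝ)) i * ‖X i‖ ≤ s) → ∀ b, w 3 b * ‖Dt A' X b‖ ≤ θ₀ * r * s :=
    fun A' r h1 h2 h3 X s hX b => h73t A' r h1 h2 h3 X s hX b
  exact main (fun _ => 1) 2 θ₀ h₀ ℓ ((F.P K).L : ℝ) (fun _ => zero_le_one) hband hθ₀ hh₀ hℓ hℓ hℓε hQt' h73t' h46t hQ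

end Summit.QuantumFields.YangMills.Theorems.K0Stub1SectFWSlotAtRecordFlatChart

end
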